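import Literature.Probability.RandomPlanarGeometry.SLERestrictionLocal
import Literature.Probability.RandomPlanarGeometry.SimplePathConfig
import Literature.Probability.RandomPlanarGeometry.RestrictionMeasuresBubbles
import HarnessLib

/-!
# "The law of `γ(0, ∞)` is therefore `P_{5/8}`" ([LSW] Thm. 6.1, second sentence): the SLE_{8/3} curve as a random element of `Ω`

Proof-only file (no new definition, no new named fact), after

* G. F. Lawler, O. Schramm, W. Werner, *Conformal restriction: the chordal case*, J. Amer. Math.
  Soc. **16** (2003) 917–955, arXiv:math/0209343 (**[LSW]**, arXiv page numbers), Thm. 6.1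
  (p. 23): "Let `γ` be the SLE_{8/3} path starting at the origin and `A ∈ 𝒬*`, then
  `P[γ[0, ∞) ∩ A = ∅] = Φ'_A(0)^{5/8}`. The law of `γ(0, ∞)` is therefore `P_{5/8}`."; p. 7:
  "`K = γ(0, ∞) ∈ Ω`" presupposes that `γ` is a simple curve from `0` to `∞` in `ℍ` (Rohde–Schramm
  2005, Thms. 5.1, 6.1, 7.1); p. 5 result 1 ("`P_α` exists iff `α ≥ 5/8`") and result 2 ("The only
  measure `P_α` that is supported on simple curves is `P_{5/8}`. It is the law of chordal SLE_{8/3}").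

The first sentence of Thm. 6.1 is the named fact `sle_restriction_eightThirds` (`RestrictionHulls`),
which the tree reduces to `HasSLETrace (8/3)` (Rohde–Schramm Thm. 5.1 at `κ = 8/3`) and
`sle_exists_isRestrictionMartingale` ([LSW] Prop. 5.2/5.3) in
`sle_restriction_eightThirds_of_hasSLETrace` (`SLERestrictionLocal`). This file proves the SECOND
sentence from the first and `HasSLETrace (8/3)` alone:

* `ae_isChordalSimplePath_sleTrace_eightThirds` — given `HasSLETrace (8/3)`, almost every SLE_{8/3}
  trace is a simple path from `0` to `∞` in `ℍ` (`IsChordalSimplePath`, `SimplePathConfig`): it is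
  continuous and starts at `0` for every sample (`continuous_sleTrace`, `sleTrace_zero`), is a.s.
  simple (Rohde–Schramm Thm. 6.1, `ae_isSimpleTrace_sleTrace_of_hasSLETrace`) and a.s. transient
  (Thm. 7.1, `tendsto_norm_sleTrace_atTop_eightThirds_of_hasSLETrace`) — so that `γ(0, ∞) ∈ Ω`
  (`IsChordalSimplePath.toConfig`, [LSW] Def. 3.1's example, proved in `SimplePathConfig`);
* `disjoint_image_Ioi_iff_rat` — deterministic: for a continuous path `γ` and a nonempty closed `A`,
  `γ(0, ∞) ∩ A = ∅` iff on every time window `[1/(n+1), n+1]` the distances `dist(γ(q), A)` at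
  RATIONAL times `q` are bounded below by some `1/(m+1)` (compactness and density) — the
  countable description that makes the avoidance events measurable;
* `exists_measurable_sleTrace_eightThirds_version` — **`γ(0, ∞)` has an `Ω`-valued version
  measurable for the avoidance σ-field** ([LSW] §3 p. 10): modify `ω ↦ γ_ω(0, ∞)` off a measurable
  full-measure set on which the trace is a chordal simple path whose values at rational times are
  given by measurable maps (the marginals of the trace are a.e.-measurable,
  `aemeasurable_sleTrace_holds`); the avoidance event of `A ∈ 𝒬*` is then the countable Boolean
  combination above (`RestrictionConfig.measurable_of_measurableSet_disjoint`);
* `sleTrace_eightThirds_isRestrictionMeasure_map` — **Thm. 6.1, second sentence**: given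
  `HasSLETrace (8/3)` and the avoidance formula `sle_restriction_eightThirds`, the law of that
  version is a two-sided restriction measure of exponent `5/8` (`IsRestrictionMeasure (5/8)`; with
  the uniqueness of Prop. 3.3, `IsRestrictionMeasure.unique'`, it is THE `P_{5/8}`:
  `IsRestrictionMeasure.eq_map_sleTrace_eightThirds`), and it is supported on simple curves in the
  outer sense of `IsRestrictionMeasure.eq_five_eighths_of_outer_simple` (`…_measure_eq_one_of_subset`);
* `exists_isRestrictionMeasure_five_eighths_of_hasSLETrace` (`…_of_martingale`) — hence **`P_{5/8}`
  exists**, from `HasSLETrace (8/3)` and Thm. 6.1 (resp. Prop. 5.2/5.3);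
* `exists_isRestrictionMeasure_iff_of_hasSLETrace` — [LSW] p. 5 result 1
  (`exists_isRestrictionMeasure_iff`) from: Cor. 8.6 (`not_exists_isRestrictionMeasure_of_lt_five_eighths`),
  Thm. 7.3 in the existential form of `RestrictionMeasuresBubbles`
  (`exists_isRestrictionMeasure_ae_interior_nonempty`, `α > 5/8`) and, at `α = 5/8`, SLE_{8/3}
  (`HasSLETrace (8/3)` with `sle_restriction_eightThirds`).
-/

noncomputable section

open Set Filter Topology MeasureTheory Metric
open UpperHalfPlane (upperHalfPlaneSet)
open scoped NNReal ENNReal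
open Literature.Probability.Process (preWienerMeasure)

namespace Literature.Probability.RandomPlanarGeometry

/-! ### The SLE_{8/3} trace is almost surely a simple path from `0` to `∞` in `ℍ` -/

/-- **Almost every SLE_{8/3} trace is a simple path from `0` to `∞` in the upper half-plane**,
given that SLE_{8/3} is generated by a curve (`HasSLETrace (8/3)`, Rohde–Schramm Thm. 5.1): it is
continuous with `γ(0) = 0` for every sample, almost surely simple and in `ℍ` at positive times
(Rohde–Schramm Thm. 6.1, `κ = 8/3 ≤ 4`) and almost surely transient (Thm. 7.1).
[cite: RohdeSchramm2005, Thms. 5.1, 6.1, 7.1] -/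
theorem ae_isChordalSimplePath_sleTrace_eightThirds (hgen : HasSLETrace ((8 : ℝ≥0) / 3)) :
    ∀ᵐ ω ∂preWienerMeasure, IsChordalSimplePath (sleTrace ((8 : ℝ≥0) / 3) ω) := by
  have h4 : (8 : ℝ≥0) / 3 ≤ 4 := by
    rw [div_le_iff₀ (by norm_num : (0 : ℝ≥0) < 3)]
    norm_num
  filter_upwards [ae_isSimpleTrace_sleTrace_of_hasSLETrace hgen h4,
    tendsto_norm_sleTrace_atTop_eightThirds_of_hasSLETrace hgen] with ω h₁ h₂
  exact ⟨continuous_sleTrace _ ω, h₁, sleTrace_zero _ ω, h₂⟩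

/-! ### A countable description of the avoidance events of a continuous path -/

/-- **Avoidance at rational times.** For a continuous path `γ : [0, ∞) → ℂ` and a nonempty closed
set `A`, `γ(0, ∞) ∩ A = ∅` iff for every `n` there is an `m` with `dist(γ(q), A) ≥ 1/(m+1)` for
all rational times `q ∈ [1/(n+1), n+1]`. (`→`: on the compact window the continuous positive
function `t ↦ dist(γ(t), A)` is bounded below; `←`: the closed set `{t : dist(γ(t), A) ≥ 1/(m+1)}`
contains the rationals of the open window, which are dense in it.) [folklore] -/
theorem disjoint_image_Ioi_iff_rat {γ : ℝ≥0 → ℂ} (hγ : Continuous γ) {A : Set ℂ}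
    (hA : IsClosed A) (hne : A.Nonempty) :
    Disjoint (γ '' Ioi 0) A ↔
      ∀ n : ℕ, ∃ m : ℕ, ∀ q : ℚ, (1 / (n + 1) : ℝ) ≤ q → (q : ℝ) ≤ n + 1 →
        (1 / (m + 1) : ℝ) ≤ infDist (γ (Real.toNNReal q)) A := by
  -- the distance to `A` in real time
  set f : ℝ → ℝ := fun s ↦ infDist (γ (Real.toNNReal s)) A with hf
  have hfc : Continuous f := (continuous_infDist_pt A).comp (hγ.comp continuous_real_toNNReal)
  constructor
  · intro hdisj n
    have hn0 : (0 : ℝ) < n + 1 := by positivity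
    have hab : (1 / (n + 1) : ℝ) ≤ n + 1 := by
      have h1 : (1 / (n + 1) : ℝ) ≤ 1 := by
        rw [div_le_one hn0]
        linarith [(n.cast_nonneg : (0 : ℝ) ≤ n)]
      linarith [(n.cast_nonneg : (0 : ℝ) ≤ n)]
    obtain ⟨t₀, ht₀, hmin⟩ :=
      isCompact_Icc.exists_isMinOn (nonempty_Icc.2 hab) hfc.continuousOn
    rw [isMinOn_iff] at hmin
    have hpos : 0 < f t₀ := by
      have ht₀pos : 0 < t₀ := lt_of_lt_of_le (by positivity) ht₀.1
      have hmem : γ (Real.toNNReal t₀) ∈ γ '' Ioi 0 := ⟨_, by simpa using ht₀pos, rfl⟩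
      exact (hA.notMem_iff_infDist_pos hne).1 (Set.disjoint_left.1 hdisj hmem)
    obtain ⟨m, hm⟩ := exists_nat_one_div_lt hpos
    exact ⟨m, fun q hq₁ hq₂ ↦ hm.le.trans (hmin q ⟨hq₁, hq₂⟩)⟩
  · intro h
    rw [Set.disjoint_left]
    rintro _ ⟨t, ht, rfl⟩ hzA
    have ht' : (0 : ℝ) < t := NNReal.coe_pos.2 ht
    -- a window `(1/(n+1), n+1)` containing `t` in its interior
    obtain ⟨n₁, hn₁⟩ := exists_nat_gt (t : ℝ)
    obtain ⟨n₂, hn₂⟩ := exists_nat_gt (1 / (t : ℝ))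
    have hnt : (t : ℝ) < (n₁ + n₂ : ℕ) + 1 := by
      push_cast
      linarith [(n₂.cast_nonneg : (0 : ℝ) ≤ n₂)]
    have hnt' : (1 / ((n₁ + n₂ : ℕ) + 1) : ℝ) < t := by
      have h1 : 1 / (t : ℝ) < (n₁ + n₂ : ℕ) + 1 := by
        push_cast
        linarith [(n₁.cast_nonneg : (0 : ℝ) ≤ n₁)]
      calc (1 / ((n₁ + n₂ : ℕ) + 1) : ℝ) < 1 / (1 / t) := one_div_lt_one_div_of_lt (by positivity) h1
        _ = t := one_div_one_div _
    obtain ⟨m, hm⟩ := h (n₁ + n₂)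
    -- the closed set where the bound holds contains the rationals of the open window, hence `t`
    have hC : IsClosed {s : ℝ | (1 / (m + 1) : ℝ) ≤ f s} := isClosed_le continuous_const hfc
    have hsub : Ioo (1 / ((n₁ + n₂ : ℕ) + 1) : ℝ) ((n₁ + n₂ : ℕ) + 1) ⊆
        {s : ℝ | (1 / (m + 1) : ℝ) ≤ f s} := by
      intro s hs
      have hcl : s ∈ closure (Ioo (1 / ((n₁ + n₂ : ℕ) + 1) : ℝ) ((n₁ + n₂ : ℕ) + 1) ∩
          range ((↑) : ℚ → ℝ)) :=
        Dense.open_subset_closure_inter Rat.denseRange_cast isOpen_Ioo hs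
      refine hC.closure_subset_iff.2 ?_ hcl
      rintro _ ⟨hs', q, rfl⟩
      exact hm q hs'.1.le hs'.2.le
    have hle : (1 / (m + 1) : ℝ) ≤ f t := hsub ⟨hnt', hnt⟩
    have hft : f t = 0 := by
      simp only [hf, Real.toNNReal_coe]
      exact infDist_zero_of_mem hzA
    have hmpos : (0 : ℝ) < 1 / (m + 1) := by positivity
    linarith

/-! ### An `Ω`-valued measurable version of `γ(0, ∞)` -/

/-- **The SLE_{8/3} curve as a random element of `Ω`** ([LSW] p. 7: "`K = γ(0, ∞) ∈ Ω`"; §3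
p. 10, the avoidance σ-field): given `HasSLETrace (8/3)`, there is a map `Kc` from the Wiener space
to `Ω`, measurable for the σ-field generated by the events `{K ∩ A = ∅}`, `A ∈ 𝒬*`, which almost
surely is the configuration `γ(0, ∞)` of the trace, a chordal simple path. Construction: on a
measurable set `S` of full measure the trace is a chordal simple path and its values at rational
times agree with measurable modifications `G_q` of the (a.e.-measurable, `aemeasurable_sleTrace_holds`)
marginals; put `Kc = γ(0, ∞)` on `S` and the imaginary half-axis off `S`. For `A ∈ 𝒬*` nonempty
(closed), `{Kc ∩ A = ∅} ∩ S` is `S ∩ ⋂ₙ ⋃ₘ ⋂_q {dist(G_q, A) ≥ 1/(m+1)}` by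
`disjoint_image_Ioi_iff_rat`. [cite: LawlerSchrammWerner2003Restriction, Thm. 6.1 (p. 23) with §3 p. 10] -/
theorem exists_measurable_sleTrace_eightThirds_version (hgen : HasSLETrace ((8 : ℝ≥0) / 3)) :
    ∃ Kc : (ℝ≥0 → ℝ) → RestrictionConfig, Measurable Kc ∧
      ∀ᵐ ω ∂preWienerMeasure, IsChordalSimplePath (sleTrace ((8 : ℝ≥0) / 3) ω) ∧
        (Kc ω : Set ℂ) = sleTrace ((8 : ℝ≥0) / 3) ω '' Ioi 0 := by
  classical
  -- measurable modifications of the marginals at rational times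
  have hmk : ∀ q : ℚ, AEMeasurable (fun ω ↦ sleTrace ((8 : ℝ≥0) / 3) ω (Real.toNNReal q))
      preWienerMeasure := fun q ↦ aemeasurable_sleTrace_holds hgen _
  set G : ℚ → (ℝ≥0 → ℝ) → ℂ := fun q ↦ (hmk q).mk _ with hG
  have hGm : ∀ q, Measurable (G q) := fun q ↦ (hmk q).measurable_mk
  have hGae : ∀ᵐ ω ∂preWienerMeasure, ∀ q : ℚ, sleTrace ((8 : ℝ≥0) / 3) ω (Real.toNNReal q) = G q ω :=
    ae_all_iff.2 fun q ↦ (hmk q).ae_eq_mk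
  -- a measurable set of full measure on which the trace is a chordal simple path given by `G`
  have hgood : ∀ᵐ ω ∂preWienerMeasure, IsChordalSimplePath (sleTrace ((8 : ℝ≥0) / 3) ω) ∧
      ∀ q : ℚ, sleTrace ((8 : ℝ≥0) / 3) ω (Real.toNNReal q) = G q ω :=
    (ae_isChordalSimplePath_sleTrace_eightThirds hgen).and hGae
  obtain ⟨S, hSm, hSae, hS⟩ : ∃ S : Set (ℝ≥0 → ℝ), MeasurableSet S ∧
      (∀ᵐ ω ∂preWienerMeasure, ω ∈ S) ∧
        ∀ ω ∈ S, IsChordalSimplePath (sleTrace ((8 : ℝ≥0) / 3) ω) ∧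
          ∀ q : ℚ, sleTrace ((8 : ℝ≥0) / 3) ω (Real.toNNReal q) = G q ω := by
    rw [ae_iff] at hgood
    obtain ⟨T, hNT, hTm, hT0⟩ := exists_measurable_superset_of_null hgood
    refine ⟨Tᶜ, hTm.compl, compl_mem_ae_iff.2 hT0, fun ω hω ↦ ?_⟩
    by_contra h
    exact hω (hNT h)
  -- the version: `γ(0, ∞)` on `S`, the imaginary half-axis off `S`
  refine ⟨fun ω ↦ if h : ω ∈ S then (hS ω h).1.toConfig else RestrictionConfig.imaginaryAxis,
    ?_, ?_⟩
  · refine RestrictionConfig.measurable_of_measurableSet_disjoint fun A hA ↦ ?_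
    rcases A.eq_empty_or_nonempty with rfl | hne
    · simp
    have hAc : IsClosed A := hA.isBoundedHull.isClosed
    -- the countable description of the event on `S`
    have himp : ∀ (P : Prop) {s : Set (ℝ≥0 → ℝ)}, MeasurableSet s →
        MeasurableSet {ω | P → ω ∈ s} := by
      intro P s hs
      by_cases hP : P
      · simpa [hP] using hs
      · simp [hP]
    set E : Set (ℝ≥0 → ℝ) := {ω | ∀ n : ℕ, ∃ m : ℕ, ∀ q : ℚ, (1 / (n + 1) : ℝ) ≤ q →
        (q : ℝ) ≤ n + 1 → (1 / (m + 1) : ℝ) ≤ infDist (G q ω) A} with hE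
    have hEeq : E = ⋂ n : ℕ, ⋃ m : ℕ, ⋂ q : ℚ, {ω | (1 / (n + 1) : ℝ) ≤ q → (q : ℝ) ≤ n + 1 →
        (1 / (m + 1) : ℝ) ≤ infDist (G q ω) A} := by
      ext ω
      simp only [hE, mem_setOf_eq, mem_iInter, mem_iUnion]
    have hEm : MeasurableSet E := by
      rw [hEeq]
      exact MeasurableSet.iInter fun n ↦ MeasurableSet.iUnion fun m ↦
        MeasurableSet.iInter fun q ↦ himp _ (himp _
          (measurableSet_le measurable_const ((continuous_infDist_pt A).measurable.comp (hGm q))))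
    have heq : {ω | Disjoint (((if h : ω ∈ S then (hS ω h).1.toConfig
        else RestrictionConfig.imaginaryAxis : RestrictionConfig) : Set ℂ)) A} =
          (S ∩ E) ∪ (Sᶜ ∩ {_ω | Disjoint ((RestrictionConfig.imaginaryAxis : RestrictionConfig) :
            Set ℂ) A}) := by
      ext ω
      simp only [mem_setOf_eq, mem_union, mem_inter_iff, mem_compl_iff]
      by_cases hω : ω ∈ S
      · rw [dif_pos hω, IsChordalSimplePath.coe_toConfig,
          disjoint_image_Ioi_iff_rat (continuous_sleTrace _ ω) hAc hne]
        simp only [hω, true_and, not_true_eq_false, false_and, or_false, hE, mem_setOf_eq,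
          (hS ω hω).2]
      · rw [dif_neg hω]
        simp [hω]
    rw [heq]
    exact (hSm.inter hEm).union (hSm.compl.inter (MeasurableSet.const _))
  · filter_upwards [hSae] with ω hω
    exact ⟨(hS ω hω).1, by simp only [dif_pos hω, IsChordalSimplePath.coe_toConfig]⟩

/-! ### The law of `γ(0, ∞)` is `P_{5/8}` -/

/-- **[LSW] Theorem 6.1, second sentence: "The law of `γ(0, ∞)` is therefore `P_{5/8}`."** Given
that SLE_{8/3} is generated by a curve (`hgen`) and the avoidance formula of Thm. 6.1 (`h61`,
`sle_restriction_eightThirds`: `P[γ[0, ∞) ∩ A = ∅] = Φ'_A(0)^{5/8}` for `A ∈ 𝒬*`), the law of the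
`Ω`-valued version `Kc` of `γ(0, ∞)` is a two-sided restriction measure of exponent `5/8`
(`IsRestrictionMeasure (5/8)`, Prop. 3.3 (3) / Def. 3.4): `{Kc ∩ A = ∅}` and `{γ[0, ∞) ∩ A = ∅}`
differ by a null set, as `γ[0, ∞) = γ(0, ∞) ∪ {0}` and `0 ∉ A`.
[cite: LawlerSchrammWerner2003Restriction, Thm. 6.1 (p. 23), second sentence] -/
theorem sleTrace_eightThirds_isRestrictionMeasure_map (hgen : HasSLETrace ((8 : ℝ≥0) / 3))
    (h61 : sle_restriction_eightThirds) :
    ∃ Kc : (ℝ≥0 → ℝ) → RestrictionConfig, Measurable Kc ∧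
      (∀ᵐ ω ∂preWienerMeasure, IsChordalSimplePath (sleTrace ((8 : ℝ≥0) / 3) ω) ∧
        (Kc ω : Set ℂ) = sleTrace ((8 : ℝ≥0) / 3) ω '' Ioi 0) ∧
        IsRestrictionMeasure (5 / 8) (preWienerMeasure.map Kc) := by
  obtain ⟨Kc, hKc, hae⟩ := exists_measurable_sleTrace_eightThirds_version hgen
  haveI : IsProbabilityMeasure preWienerMeasure := isProbabilityMeasure_preWienerMeasure'
  refine ⟨Kc, hKc, hae, IsRestrictionMeasure.map_of_measure_disjoint hKc fun {A} hA Φ hΦ d hd ↦ ?_⟩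
  have heq : {ω | Disjoint ((Kc ω : Set ℂ)) A} =ᵐ[preWienerMeasure]
      {ω | Disjoint (range (sleTrace ((8 : ℝ≥0) / 3) ω)) A} := by
    filter_upwards [hae] with ω hω
    show (Disjoint ((Kc ω : Set ℂ)) A) = Disjoint (range (sleTrace ((8 : ℝ≥0) / 3) ω)) A
    rw [hω.2, hω.1.range_eq, Set.disjoint_union_left, Set.disjoint_singleton_left, eq_iff_iff]
    exact ⟨fun h ↦ ⟨h, hA.zero_notMem⟩, fun h ↦ h.1⟩
  rw [measure_congr heq]
  exact h61 hA hΦ hd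

/-- **`P_{5/8}` exists, from SLE_{8/3}** (the case `α = 5/8` of the "if" half of [LSW] p. 5 result
1): given `HasSLETrace (8/3)` and Thm. 6.1, the law of `γ(0, ∞)` is a `P_{5/8}`.
[cite: LawlerSchrammWerner2003Restriction, Thm. 6.1 (p. 23) with p. 5 result 1] -/
theorem exists_isRestrictionMeasure_five_eighths_of_hasSLETrace (hgen : HasSLETrace ((8 : ℝ≥0) / 3))
    (h61 : sle_restriction_eightThirds) :
    ∃ P : Measure RestrictionConfig, IsRestrictionMeasure (5 / 8) P := by
  obtain ⟨Kc, -, -, hP⟩ := sleTrace_eightThirds_isRestrictionMeasure_map hgen h61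
  exact ⟨_, hP⟩

/-- The same from `HasSLETrace (8/3)` and **[LSW] Prop. 5.2/5.3** (`hM`: the restriction martingales
`h_t'(W_t)^{5/8}` exist), Thm. 6.1 being supplied by `sle_restriction_eightThirds_of_hasSLETrace`.
[cite: LawlerSchrammWerner2003Restriction, Thm. 6.1 (p. 23) with Prop. 5.2 (§5)] -/
theorem exists_isRestrictionMeasure_five_eighths_of_hasSLETrace_of_martingale
    (hgen : HasSLETrace ((8 : ℝ≥0) / 3)) (hM : sle_exists_isRestrictionMartingale) :
    ∃ P : Measure RestrictionConfig, IsRestrictionMeasure (5 / 8) P :=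
  exists_isRestrictionMeasure_five_eighths_of_hasSLETrace hgen
    (sle_restriction_eightThirds_of_hasSLETrace hgen hM)

/-- **`P_{5/8}` IS the law of the SLE_{8/3} curve** (Thm. 6.1, second sentence, read with the
uniqueness of Prop. 3.3, `IsRestrictionMeasure.unique'`): every two-sided restriction measure of
exponent `5/8` is the law of the version `Kc` of `γ(0, ∞)`.
[cite: LawlerSchrammWerner2003Restriction, Thm. 6.1 (p. 23) with Prop. 3.3 (pp. 10–11)] -/
theorem IsRestrictionMeasure.eq_map_sleTrace_eightThirds (hgen : HasSLETrace ((8 : ℝ≥0) / 3))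
    (h61 : sle_restriction_eightThirds) {P : Measure RestrictionConfig}
    (hP : IsRestrictionMeasure (5 / 8) P) :
    ∃ Kc : (ℝ≥0 → ℝ) → RestrictionConfig, Measurable Kc ∧
      (∀ᵐ ω ∂preWienerMeasure, IsChordalSimplePath (sleTrace ((8 : ℝ≥0) / 3) ω) ∧
        (Kc ω : Set ℂ) = sleTrace ((8 : ℝ≥0) / 3) ω '' Ioi 0) ∧
        P = preWienerMeasure.map Kc := by
  obtain ⟨Kc, hKc, hae, hQ⟩ := sleTrace_eightThirds_isRestrictionMeasure_map hgen h61
  exact ⟨Kc, hKc, hae, hP.unique' hQ⟩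

/-- **`P_{5/8}` is supported on simple curves** ([LSW] p. 5 result 2: "The only measure `P_α` that
is supported on simple curves is `P_{5/8}`. It is the law of chordal SLE_{8/3}", the `P_{5/8}` half;
Thm. 6.1 with Rohde–Schramm), in the outer reading of
`IsRestrictionMeasure.eq_five_eighths_of_outer_simple`: every measurable event of `Ω` containing all
simple-curve configurations is `P_{5/8}`-almost sure — for `P_{5/8}` is the law of `Kc`, which is
almost surely the set `γ(0, ∞)` of a chordal simple path `γ`, a simple curve in the sense of
`RestrictionConfig.IsSimplePath`.
[cite: LawlerSchrammWerner2003Restriction, p. 5 result 2 with Thm. 6.1 (p. 23)] -/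
theorem IsRestrictionMeasure.measure_eq_one_of_isSimplePath_subset
    (hgen : HasSLETrace ((8 : ℝ≥0) / 3)) (h61 : sle_restriction_eightThirds)
    {P : Measure RestrictionConfig} (hP : IsRestrictionMeasure (5 / 8) P)
    {E : Set RestrictionConfig} (hE : MeasurableSet E) (hsub : {K | K.IsSimplePath} ⊆ E) :
    P E = 1 := by
  obtain ⟨Kc, hKc, hae, rfl⟩ := hP.eq_map_sleTrace_eightThirds hgen h61
  haveI : IsProbabilityMeasure preWienerMeasure := isProbabilityMeasure_preWienerMeasure'
  rw [Measure.map_apply hKc hE, ← measure_univ (μ := preWienerMeasure)]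
  refine measure_congr ?_
  filter_upwards [hae] with ω hω
  have hmem : Kc ω ∈ E :=
    hsub ⟨sleTrace ((8 : ℝ≥0) / 3) ω, hω.1.continuous, hω.1.injective, hω.1.apply_zero,
      hω.1.tendsto_norm, hω.2⟩
  exact propext ⟨fun _ ↦ trivial, fun _ ↦ hmem⟩

/-! ### [LSW] p. 5 result 1 with the `α = 5/8` case supplied by SLE_{8/3} -/

/-- **[LSW] p. 5 result 1** (`exists_isRestrictionMeasure_iff`: for `α > 0`, `P_α` exists iff
`α ≥ 5/8`) **from Cor. 8.6, Thm. 7.3 (`α > 5/8`) and SLE_{8/3} (`α = 5/8`)**: the "only if" half is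
Cor. 8.6 (`h86`, with the proved positivity of the exponent, `IsRestrictionMeasure.five_eighths_le`);
existence for `α > 5/8` is Thm. 7.3 in the existential form of `RestrictionMeasuresBubbles` (`h73`);
existence at `α = 5/8` is Thm. 6.1 (`h61`) for the SLE_{8/3} curve (`hgen`).
[cite: LawlerSchrammWerner2003Restriction, p. 5 result 1; Thm. 6.1 (p. 23), Thm. 7.3 (p. 29), Cor. 8.6 (p. 37)] -/
theorem exists_isRestrictionMeasure_iff_of_hasSLETrace (hgen : HasSLETrace ((8 : ℝ≥0) / 3))
    (h61 : sle_restriction_eightThirds) (h73 : exists_isRestrictionMeasure_ae_interior_nonempty)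
    (h86 : not_exists_isRestrictionMeasure_of_lt_five_eighths) : exists_isRestrictionMeasure_iff := by
  intro α _
  refine ⟨fun ⟨P, hP⟩ ↦ hP.five_eighths_le h86, fun hα ↦ ?_⟩
  rcases hα.eq_or_lt with rfl | hlt
  · exact exists_isRestrictionMeasure_five_eighths_of_hasSLETrace hgen h61
  · exact exists_isRestrictionMeasure_of_gt_five_eighths_of_bubbles h73 hlt

end Literature.Probability.RandomPlanarGeometry

end
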